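/-
Copyright (c) 2026 the pub-hodgecm-mathlib formalisation cell (harness21).  Prover seat hodgecm-mathlib-K2E3-p34 (g2), Track B «K2-LIT» ∕ h413 = `stmt-HodgeConjecture-24833`,
line `K2_E3_EllipticInputs`, unit U4 «Keys», socket :182 `sig_K2E3KeysThmTwoContractingRamifiedCharOnePosDepth`, programme A_pos (both regimes): brick (B1) «CONDUCTOR LETTERS
FROM CONTINUITY» — the exact E-conductor `m + 1`, the exact F-conductor `k + 1 ≤ m + 1` and their witness units, from :182's `h₁` (continuity), `hpos` (positive depth) and `hA`
(Branch A); K2E3-p37 (g2)'s MEMO-PosA-Recut §2 (B1), dealer K2E3-plan (g5), K2 bus 2026-09-04T22:56Z.  KERNEL module: THEOREMS ONLY.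
-/
import Summits.HodgeConjecture.HodgeConjecture.Theorems.K2E3LevelNDepthWitnessCM             -- ★ §10 (b) (R90-C10-p02 g2): the CM currency of the letters `hcond`, `u₁`, `hu₁`, `hχu₁` (`LocalRing`, `PlacesOver`, `conjLocal`); brings ★ `UnitaryGroup.conjLocal_conjLocal_cm`, ★ `HermitianLattice.v_lt_one_iff`
import Literature.NumberTheory.Automorphic.LocalRingUnitsCharacterLocallyConstant           -- ★ `UnitaryGroup.exists_forall_box_apply_eq_one` (a continuous `ℂˣ`-character of `(Π_{w∣v} L_w)ˣ` is trivial on a principal congruence box)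
import HarnessLib

/-!
# K2 ∕ E3 «EllipticInputs», unit U4 «Keys» — (U4f-χ₁-ram-one-pos), programme A_pos brick (B1): THE CONDUCTOR LETTERS FROM CONTINUITY
# «`h₁ ∧ hpos ⟹ ∃ m ≥ 1`: `χ₁ = 1` on `{∀ w′, |u_{w′} − 1| ≤ |ϖ|^{m+1}}` and `χ₁ u₁ ≠ 1` for some `|u₁ − 1| ≤ |ϖ|^m`;  `hA ⟹ ∃ k ≤ m`: the same on the `(c ⊗ 1)`-FIXED units at depth `k+1`,
# with a fixed witness at depth `k`»   [TateThesis1967 §2.3; Roche1998 §3; Keys1984 §7; Rogawski1990 §12.2; PlatonovRapinchuk1994 §5.1]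

Cell hodgecm-mathlib, Track B «K2-LIT», crux item H413 = stmt-HodgeConjecture-24833 (route `HCCMUnconditional`, no route verbs); target BY NAME the OPEN tier-0 leaf
`…K2E3EllipticInputs.U4Keys.sig_K2E3KeysThmTwoContractingRamifiedCharOnePosDepth` (U4Keys :182).  Author K2E3-p34 (g2).  `--supports stmt-HodgeConjecture-24833 --as helper`; THEOREMS
ONLY (no `def` ∕ `instance` ∕ `notation` ∕ named fact ∕ `sorry`); FRAME-FREE CM level (`L`, `v`, a place `w ∣ v` with a uniformiser `ϖ` — the currency of ★ §10 (b) ∕ ★ p861880's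
letters; no `eA`; §3 uses the non-split hypothesis `hw` only to read `(c ⊗ 1)` at the one place).  NOT THE PAYER of :182.

THE POINT.  Every positive-depth brick of design D-I is HYPOTHESIS-FIRST over conductor letters that the socket :182 does not carry: `hcond` («`χ₁ u = 1` whenever `|u_{w′} − 1| ≤
|ϖ|^{m+1}` for all `w′`», ★ `K2E3LevelNIwahoriCharacterCM` ∕ ★ `K2E3LevelNDepthWitnessCM` ∕ ★ `K2E3ConcaveLevelIwahoriCharacterCM` ∕ ★ `K2E3TwoDepthDepthWitnessCM`), the
EXACT-conductor witness `u₁` (`|(u₁)_{w′} − 1| ≤ |ϖ|^m`, `χ₁ u₁ ≠ 1`), and — in the two-depth (Roche) regime A_pos^{<} — the F-side pair `hcondF` («`χ₁ u = 1` for `(c ⊗ 1)u = u`,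
`|u_{w′} − 1| ≤ |ϖ|^{k+1}`») with a FIXED witness `u₂` at depth `k ≤ m` (★ p862709's `hcondF`, ★ p862772's `u₂ hσu₂ hu₂ hχu₂`).  The socket offers instead `h₁ : Continuous (χ₁ · : ℂ)`,
`hpos : ∃ u, (∀ w′, |u_{w′} − 1| < 1) ∧ χ₁ u ≠ 1` and (Branch A) `hA : χ₁(u·σu) ≠ 1` for a unit `u`.  THIS FILE derives the letters from the socket: a continuous `ℂˣ`-character of
`(Π_{w′∣v} L_{w′})ˣ` is trivial on a principal congruence box (★ `exists_forall_box_apply_eq_one` — `ℂˣ` has no small subgroups), so the predicate `P j` := «`χ₁ = 1` at depth `j`»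
holds for large `j`; it is MONOTONE in `j` and FALSE at `j = 1` by `hpos` (discreteness `|x| < 1 ⟺ |x| ≤ |ϖ|`, ★ `HermitianLattice.v_lt_one_iff`), so its least index `Nat.find` is an
`m + 1` with `m ≥ 1`, and the failure of `P m` is the witness `u₁`.  The same on the `(c ⊗ 1)`-fixed units gives `k + 1 ≤ m + 1`; when the least fixed index is `0` (cond_F ≤ 1) the
Branch-A unit `u·σu` is the depth-`0` fixed witness, so the output is uniform in `k`.
* §1 `continuous_units_of_continuous_coe` (`h₁` ⟹ `Continuous χ₁` into `ℂˣ`), `apply_eq_one_mono` (monotonicity of the depth predicate), `valued_le_pow_succ_lt_exp` ∕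
  `valued_le_uniformiser_of_lt_one` (the two valuation conversions).
* §2 **`exists_conductor_letters`** (`∃ m ≥ 1, hcond(m+1) ∧ ∃ u₁, hu₁ ∧ hχu₁`).
* §3 `isFixed_mul_map_conjLocal` (`u·σu` is `(c ⊗ 1)`-fixed), **`exists_fixedConductor_letters`** (`∃ k ≤ m, hcondF(k+1) ∧ ∃ u₂, hσu₂ ∧ hu₂ ∧ hχu₂`, from `hcond(m+1)` and `hA`).
HONEST LABEL: HC_CM is proved only modulo the 7 printed citations (2 remaining named inputs: hLiu418 = stmt-HodgeConjecture-24832, h413 = stmt-HodgeConjecture-24833)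
until rung 0 closes; count-neutral — this file pays no socket and closes nothing; no printed citation is discharged.

## References
* [TateThesis1967] J. Tate, *Fourier analysis in number fields and Hecke's zeta-functions* (1950∕1967), §2.3 (a quasi-character of a local field is trivial on some `1 + 𝔭ⁿ`; the conductor).
* [Roche1998] A. Roche, *Types and Hecke algebras for principal series representations of split reductive p-adic groups*, Ann. Sci. ÉNS (4) 31 (1998), §3 (the conductors `c_α` of `χ∘α^∨`).
* [Keys1984] D. Keys, *Principal series representations of special unitary groups over local fields*, Compositio Math. 51 (1984), §7 Thm (2).
* [Rogawski1990] J. D. Rogawski, *Automorphic Representations of Unitary Groups in Three Variables*, Ann. of Math. Stud. 123 (1990), §12.2 (1)–(2) p. 173.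
* [PlatonovRapinchuk1994] V. Platonov, A. Rapinchuk, *Algebraic Groups and Number Theory* (1994), §5.1 (one place above a non-split `v`).
-/

set_option autoImplicit false
-- the mandated namespace has the single-problem summit's repeated segment (`HodgeConjecture.HodgeConjecture`)
set_option linter.dupNamespace false

noncomputable section

open NumberField IsDedekindDomain
open scoped Matrix MatrixGroups WithZero Valued
open Literature.NumberTheory Literature.NumberTheory.Automorphic Literature.NumberTheory.Automorphic.UnitaryGroup

namespace Summit.HodgeConjecture.HodgeConjecture.Cruxes.H413.K2E3LocalCharacterConductorLetters

variable (L : Type) [Field L] [NumberField L] [IsCMField L] (v : HeightOneSpectrum (𝓞 ↥(maximalRealSubfield L)))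
  (w : PlacesOver L v) {ϖ : w.1.adicCompletion L} (hϖ : Valued.v ϖ = WithZero.exp (-1 : ℤ))

/-! ## §1 Continuity into `ℂˣ`, monotonicity of the depth predicate, two valuation conversions -/

omit [IsCMField L] in
/-- `h₁ : Continuous (χ₁ · : ℂ)` ⟹ `Continuous χ₁` as a map into `ℂˣ` (the second coordinate of the units embedding is `(χ₁ ·)⁻¹`, continuous off `0`). [cite: TateThesis1967, §2.3] -/
theorem continuous_units_of_continuous_coe (χ₁ : (LocalRing L v)ˣ →* ℂˣ) (h₁ : Continuous fun x => ((χ₁ x : ℂˣ) : ℂ)) : Continuous χ₁ := by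
  refine Units.continuous_iff.2 ⟨h₁, ?_⟩
  simp only [Units.val_inv_eq_inv_val]
  exact h₁.inv₀ fun x => (χ₁ x).ne_zero

omit [IsCMField L] in
include hϖ in
/-- **Monotonicity of the depth predicate**: if `χ₁ = 1` on `{u : Q u ∧ ∀ w′, |u_{w′} − 1| ≤ |ϖ|ʲ}` then also on the deeper `{… ≤ |ϖ|^{j′}}`, `j ≤ j′` (`|ϖ| ≤ 1`).  Stated with an
arbitrary side predicate `Q` so that it serves both the full and the `(c ⊗ 1)`-fixed unit groups. [cite: TateThesis1967, §2.3] -/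
theorem apply_eq_one_mono (χ₁ : (LocalRing L v)ˣ →* ℂˣ) (Q : (LocalRing L v)ˣ → Prop) {j j' : ℕ} (hjj : j ≤ j')
    (hP : ∀ u : (LocalRing L v)ˣ, Q u → (∀ w' : PlacesOver L v, Valued.v (((u : LocalRing L v) w') - 1) ≤ Valued.v ϖ ^ j) → χ₁ u = 1)
    (u : (LocalRing L v)ˣ) (hQ : Q u) (hu : ∀ w' : PlacesOver L v, Valued.v (((u : LocalRing L v) w') - 1) ≤ Valued.v ϖ ^ j') : χ₁ u = 1 := by
  have hvϖ1 : Valued.v ϖ ≤ 1 := by rw [hϖ, ← WithZero.exp_zero, WithZero.exp_le_exp]; norm_num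
  exact hP u hQ fun w' => (hu w').trans (pow_le_pow_right_of_le_one' hvϖ1 hjj)

omit [IsCMField L] in
include hϖ in
/-- `|x| ≤ |ϖ|^{N+2} ⟹ |x| < q^{−(N+1)}` (`|ϖ|^{N+2} = q^{−(N+2)} < q^{−(N+1)}`): the box of ★ `exists_forall_box_apply_eq_one` contains the closed box of depth `N + 2`. [cite: TateThesis1967, §2.3] -/
theorem valued_le_pow_succ_lt_exp {w' : PlacesOver L v} {x : w'.1.adicCompletion L} {N : ℕ} (hx : Valued.v x ≤ Valued.v ϖ ^ (N + 2)) :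
    Valued.v x < WithZero.exp (-((N + 1 : ℕ) : ℤ)) := by
  refine lt_of_le_of_lt hx ?_
  rw [hϖ, ← WithZero.exp_nsmul, WithZero.exp_lt_exp]
  simp only [nsmul_eq_mul, Nat.cast_add, Nat.cast_ofNat, Nat.cast_one, mul_neg, mul_one]
  omega

omit [IsCMField L] in
include hϖ in
/-- Discreteness: `|x| < 1 ⟹ |x| ≤ |ϖ|` (★ `HermitianLattice.v_lt_one_iff`). [cite: TateThesis1967, §2.3] -/
theorem valued_le_uniformiser_of_lt_one {w' : PlacesOver L v} {x : w'.1.adicCompletion L} (hx : Valued.v x < 1) : Valued.v x ≤ Valued.v ϖ ^ 1 := by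
  rw [pow_one, hϖ]
  exact (HermitianLattice.v_lt_one_iff x).1 hx

/-! ## §2 The E-conductor `m + 1` and its witness `u₁` -/

open Classical in
omit [IsCMField L] in
include hϖ in
/-- **THE CONDUCTOR LETTERS FROM CONTINUITY.**  For a character `χ₁ : (L ⊗ L⁺_v)ˣ → ℂˣ` with CONTINUOUS `ℂ`-value (`h₁`) and POSITIVE depth (`hpos`: `χ₁ u ≠ 1` for some `u` with
`|u_{w′} − 1| < 1` at every `w′ ∣ v`), there is `m ≥ 1` with `χ₁ = 1` on `{u : ∀ w′, |u_{w′} − 1| ≤ |ϖ|^{m+1}}` (the letter `hcond` of ★ `K2E3LevelNIwahoriCharacterCM` ∕ ★ §10 (b) at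
exponent `m + 1`) and a witness `u₁` with `|(u₁)_{w′} − 1| ≤ |ϖ|ᵐ` for all `w′` and `χ₁ u₁ ≠ 1` (the EXACT conductor is `m + 1`).  Proof: ★ `exists_forall_box_apply_eq_one` gives the
predicate at depth `N + 2`; its least index (`Nat.find`) is `≥ 2` by `hpos` and §1, and the failure one step below is `u₁`. [cite: TateThesis1967, §2.3] [cite: Roche1998, §3]
[cite: Keys1984, §7 Thm (2)] -/
theorem exists_conductor_letters (χ₁ : (LocalRing L v)ˣ →* ℂˣ) (h₁ : Continuous fun x => ((χ₁ x : ℂˣ) : ℂ))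
    (hpos : ∃ u : (LocalRing L v)ˣ, (∀ w' : PlacesOver L v, Valued.v (((u : LocalRing L v) w') - 1) < 1) ∧ χ₁ u ≠ 1) :
    ∃ m : ℕ, 1 ≤ m ∧
      (∀ u : (LocalRing L v)ˣ, (∀ w' : PlacesOver L v, Valued.v (((u : LocalRing L v) w') - 1) ≤ Valued.v ϖ ^ (m + 1)) → χ₁ u = 1) ∧
      ∃ u₁ : (LocalRing L v)ˣ, (∀ w' : PlacesOver L v, Valued.v (((u₁ : LocalRing L v) w') - 1) ≤ Valued.v ϖ ^ m) ∧ χ₁ u₁ ≠ 1 := by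
  -- the depth predicate and its eventual truth
  set P : ℕ → Prop := fun j => ∀ u : (LocalRing L v)ˣ, (∀ w' : PlacesOver L v, Valued.v (((u : LocalRing L v) w') - 1) ≤ Valued.v ϖ ^ j) → χ₁ u = 1 with hP
  obtain ⟨N, hN⟩ := UnitaryGroup.exists_forall_box_apply_eq_one L v χ₁ (continuous_units_of_continuous_coe L v χ₁ h₁)
  have hex : ∃ j, P j := ⟨N + 2, fun u hu => hN u fun w' => valued_le_pow_succ_lt_exp L v w hϖ (hu w')⟩
  -- its least index `n₀ ≥ 2`
  have hspec : P (Nat.find hex) := Nat.find_spec hex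
  have hnot1 : ¬ P 1 := by
    obtain ⟨u, hu, hχu⟩ := hpos
    exact fun h => hχu (h u fun w' => valued_le_uniformiser_of_lt_one L v w hϖ (hu w'))
  have hnot0 : ¬ P 0 := fun h => hnot1 fun u hu => apply_eq_one_mono L v w hϖ χ₁ (fun _ => True) (Nat.zero_le 1) (fun u _ hu' => h u hu') u trivial hu
  have h2 : 2 ≤ Nat.find hex := by
    by_contra hlt
    rw [not_le] at hlt
    interval_cases h : Nat.find hex
    · exact hnot0 (h ▸ hspec)
    · exact hnot1 (h ▸ hspec)
  -- `m := n₀ − 1`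
  refine ⟨Nat.find hex - 1, by omega, ?_, ?_⟩
  · have e : Nat.find hex - 1 + 1 = Nat.find hex := by omega
    rw [e]
    exact hspec
  · have hmin : ¬ P (Nat.find hex - 1) := Nat.find_min hex (by omega)
    simp only [hP, not_forall, exists_prop] at hmin
    obtain ⟨u₁, hu₁, hχu₁⟩ := hmin
    exact ⟨u₁, hu₁, hχu₁⟩

/-! ## §3 The F-conductor `k + 1 ≤ m + 1` on the `(c ⊗ 1)`-fixed units and its witness `u₂` -/

/-- **`u · σu` is `(c ⊗ 1)`-fixed** (`(c ⊗ 1)` is an involution of the commutative ring `L ⊗ L⁺_v`, ★ `conjLocal_conjLocal_cm`). [cite: Rogawski1990, §12.2 p. 173] -/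
theorem isFixed_mul_map_conjLocal (u : (LocalRing L v)ˣ) :
    Units.map (conjLocal L (IsCMField.complexConj L) v : LocalRing L v →* LocalRing L v) (u * Units.map (conjLocal L (IsCMField.complexConj L) v : LocalRing L v →* LocalRing L v) u) =
      u * Units.map (conjLocal L (IsCMField.complexConj L) v : LocalRing L v →* LocalRing L v) u := by
  apply Units.ext
  rw [Units.coe_map, Units.val_mul, Units.coe_map, MonoidHom.coe_coe, map_mul, UnitaryGroup.conjLocal_conjLocal_cm L v, mul_comm]

/-- The Branch-A unit `u·σu` is integral at a NON-SPLIT `v`: `|(u·σu)_{w′} − 1| ≤ 1 = |ϖ|⁰` when `|u_{w′}| = 1` for all `w′` (one place `w′ = w` above `v`; `(c ⊗ 1)` reads there as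
the isometry `σ_w`, ★ `conjLocal_apply_eq_of_smul_eq`, ★ `valued_galAdicCompletionMap`). [cite: Rogawski1990, §12.2 p. 173] [cite: PlatonovRapinchuk1994, §5.1] -/
theorem valued_mul_map_conjLocal_sub_one_le (hw : IsCMField.complexConj L • w.1 = w.1) (u : (LocalRing L v)ˣ)
    (hu : ∀ w' : PlacesOver L v, Valued.v ((u : LocalRing L v) w') = 1) (w' : PlacesOver L v) :
    Valued.v (((u * Units.map (conjLocal L (IsCMField.complexConj L) v : LocalRing L v →* LocalRing L v) u : (LocalRing L v)ˣ) : LocalRing L v) w' - 1) ≤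
      Valued.v ϖ ^ 0 := by
  obtain rfl := (PlacesOver.eq_of_smul_eq (IsCMField.complexConj L) (IsCMField.complexConj_ne_one L) w hw w').symm
  rw [pow_zero]
  refine (Valued.v.map_sub _ _).trans (max_le ?_ (by rw [Valuation.map_one]))
  have e : (((u * Units.map (conjLocal L (IsCMField.complexConj L) v : LocalRing L v →* LocalRing L v) u : (LocalRing L v)ˣ) : LocalRing L v) w) =
      (u : LocalRing L v) w * conjLocal L (IsCMField.complexConj L) v (u : LocalRing L v) w := rfl
  rw [e, map_mul, hu w, one_mul, conjLocal_apply_eq_of_smul_eq (IsCMField.complexConj L) (IsCMField.complexConj_ne_one L) v w hw,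
    valued_galAdicCompletionMap, hu w]

open Classical in
include hϖ in
/-- **THE F-CONDUCTOR LETTERS.**  Given the E-side letter `hcond` at exponent `m + 1` and the Branch-A datum `hA` (`χ₁(u·σu) ≠ 1` for a unit `u` with `|u_{w′}| = 1`), there is `k ≤ m` with
`χ₁ = 1` on the `(c ⊗ 1)`-FIXED units of depth `k + 1` (the letter `hcondF` of ★ `K2E3ConcaveLevelIwahoriCharacterCM`) and a FIXED witness `u₂` with `|(u₂)_{w′} − 1| ≤ |ϖ|ᵏ` and
`χ₁ u₂ ≠ 1` (the letters `u₂ hσu₂ hu₂ hχu₂` of ★ `K2E3TwoDepthDepthWitnessCM`).  Proof: the fixed depth predicate holds at `m + 1` (by `hcond`); if its least index is `0` take `k = 0` and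
`u₂ = u·σu` (an integral unit: `|u₂ − 1| ≤ 1`), else `k + 1 :=` the least index and `u₂ :=` a failure at depth `k`. [cite: TateThesis1967, §2.3] [cite: Roche1998, §3] [cite: Rogawski1990, §12.2 p. 173] -/
theorem exists_fixedConductor_letters (hw : IsCMField.complexConj L • w.1 = w.1) (χ₁ : (LocalRing L v)ˣ →* ℂˣ) {m : ℕ}
    (hcond : ∀ u : (LocalRing L v)ˣ, (∀ w' : PlacesOver L v, Valued.v (((u : LocalRing L v) w') - 1) ≤ Valued.v ϖ ^ (m + 1)) → χ₁ u = 1)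
    (u : (LocalRing L v)ˣ) (hu : ∀ w' : PlacesOver L v, Valued.v ((u : LocalRing L v) w') = 1)
    (hA : χ₁ (u * Units.map (conjLocal L (IsCMField.complexConj L) v : LocalRing L v →* LocalRing L v) u) ≠ 1) :
    ∃ k : ℕ, k ≤ m ∧
      (∀ u' : (LocalRing L v)ˣ, Units.map (conjLocal L (IsCMField.complexConj L) v : LocalRing L v →* LocalRing L v) u' = u' →
        (∀ w' : PlacesOver L v, Valued.v (((u' : LocalRing L v) w') - 1) ≤ Valued.v ϖ ^ (k + 1)) → χ₁ u' = 1) ∧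
      ∃ u₂ : (LocalRing L v)ˣ, Units.map (conjLocal L (IsCMField.complexConj L) v : LocalRing L v →* LocalRing L v) u₂ = u₂ ∧
        (∀ w' : PlacesOver L v, Valued.v (((u₂ : LocalRing L v) w') - 1) ≤ Valued.v ϖ ^ k) ∧ χ₁ u₂ ≠ 1 := by
  set PF : ℕ → Prop := fun j => ∀ u' : (LocalRing L v)ˣ, Units.map (conjLocal L (IsCMField.complexConj L) v : LocalRing L v →* LocalRing L v) u' = u' →
    (∀ w' : PlacesOver L v, Valued.v (((u' : LocalRing L v) w') - 1) ≤ Valued.v ϖ ^ j) → χ₁ u' = 1 with hPF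
  have hex : ∃ j, PF j := ⟨m + 1, fun u' _ hu' => hcond u' hu'⟩
  have hle : Nat.find hex ≤ m + 1 := Nat.find_min' hex (fun u' _ hu' => hcond u' hu')
  have hspec : PF (Nat.find hex) := Nat.find_spec hex
  -- the Branch-A fixed unit `u · σu`, integral: `|(uσu)_{w′} − 1| ≤ 1`
  have hfix := isFixed_mul_map_conjLocal L v u
  have hint := valued_mul_map_conjLocal_sub_one_le L v w (ϖ := ϖ) hw u hu
  by_cases h0 : Nat.find hex = 0
  · -- cond_F ≤ 1: `k = 0`, witness `u·σu`
    refine ⟨0, Nat.zero_le m, ?_, u * Units.map (conjLocal L (IsCMField.complexConj L) v : LocalRing L v →* LocalRing L v) u, hfix, hint, hA⟩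
    intro u' hu'σ hu'
    exact apply_eq_one_mono L v w hϖ χ₁ (fun x => Units.map (conjLocal L (IsCMField.complexConj L) v : LocalRing L v →* LocalRing L v) x = x) (Nat.zero_le 1)
      (fun x hx hx' => (h0 ▸ hspec) x hx hx') u' hu'σ hu'
  · -- `k + 1 :=` the least index `≥ 1`, `u₂ :=` a failure at depth `k`
    refine ⟨Nat.find hex - 1, by omega, ?_, ?_⟩
    · have e : Nat.find hex - 1 + 1 = Nat.find hex := by omega
      rw [e]
      exact hspec
    · have hmin : ¬ PF (Nat.find hex - 1) := Nat.find_min hex (by omega)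
      simp only [hPF, not_forall, exists_prop] at hmin
      obtain ⟨u₂, hσu₂, hu₂, hχu₂⟩ := hmin
      exact ⟨u₂, hσu₂, hu₂, hχu₂⟩

end Summit.HodgeConjecture.HodgeConjecture.Cruxes.H413.K2E3LocalCharacterConductorLetters

end
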